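import Summits.KontsevichZagierPeriods.KontsevichZagierPeriods.Theses.FermatIsogeny
import Summits.KontsevichZagierPeriods.KontsevichZagierPeriods.Theorems.TerasomaMultiplicationGammaHodgeSectorStubProducts
import Summits.KontsevichZagierPeriods.KontsevichZagierPeriods.Theorems.FermatIsogenyBetaProductSectorStubProductValue
import Literature.NumberTheory.Transcendental.KZRulesAssociator
import Literature.NumberTheory.Transcendental.KZLogCalculusProofs
import Literature.NumberTheory.Transcendental.KZGaussMultiplicationChain
import Literature.NumberTheory.Transcendental.KZCubeProducts
import Literature.NumberTheory.Transcendental.KZRelationsLE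

/-!
# `BetaProductSector` (stmt-KontsevichZagierPeriods-3898), line `birth` — stub `stub_linearFactor`

The LINEAR-FACTOR seam of the birth skeleton of the crux `BetaProductSector` (route FermatIsogeny,
rank 4): for positive rationals `a, b, a', b', e, d` and real-algebraic weights `c, c'` with
`c · B(a,b) = c' · B(a',b')`, the two pinned product representations
`r  = [(0,1)², c  · x^{a-1}(1-x)^{b-1}   · y^{e-1}(1-y)^{d-1}]` and
`r' = [(0,1)², c' · x^{a'-1}(1-x)^{b'-1} · y^{e-1}(1-y)^{d-1}]`
are `KZ.Equivalent` — the LIN step of the chain normal form (replace the first factor inside the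
beta-LINEAR sector) tensored with `β(e,d)`.

As registered the stub CONTAINS route crux 3 `BetaLinearSector` (stmt-KontsevichZagierPeriods-3897,
OPEN: take `e = d = 1`), so this file lands the CONDITIONAL form
`stub_linearFactor_of_betaLinearSector : BetaLinearSector → <stub signature verbatim>`.

Proof, in the formal period ring `P = FormalRep ⧸ relations` (`KZRulesAssociator`):
1. the class of a representation pinned as `[(0,1)², c · x^{a-1}(1-x)^{b-1} y^{e-1}(1-y)^{d-1}]` is
   `κ(c) · β(a,b) · β(e,d)` (`LinearFactor.toFormalPeriod_pinned`: pin to the `c`-scaling of the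
   unweighted cube Beta representation, `KZ.exists_cubeBetaRep` + one integrand-additivity move
   `KZ.of_sub_of_mem_relations_of_eqOn`;
   constants factor out, `KZ.toFormalPeriod_of_constMul`; cubes are products of Beta classes,
   `cubeProduct_holds`);
2. if `c = 0` then `c' = 0` (`B(a',b') > 0`) and `κ(0) = 0`, so both classes vanish;
3. if `c ≠ 0` then `B(a,b) = (c'/c) · B(a',b')` with `c'/c` real algebraic, and ONE instance of
   `BetaLinearSector` (on `betaRep a b` and `(c'/c) · betaRep a' b'`, values equal) gives
   `β(a,b) = κ(c'/c) · β(a',b')` in `P` (`LinearFactor.betaClass_eq_kap_mul`); with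
   `κ(c) κ(c'/c) = κ(c')` (`kap_mul`) the two classes agree;
4. equal classes are equivalent representations (`KZ.toFormalPeriod_eq_iff`).

References: Kontsevich–Zagier 2001 §1.2 (rules (1), (2)), §4.1; Koblitz–Rohrlich 1978 p. 1184.
-/

noncomputable section

open MeasureTheory Set
open scoped BigOperators

namespace Summit.KontsevichZagierPeriods.FermatIsogeny.BetaProductSectorStubs

open Literature.NumberTheory.Transcendental
open Literature.NumberTheory.Transcendental.KZ
open Summit.KontsevichZagierPeriods.GammaHodgeSectorKO
open Summit.KontsevichZagierPeriods.GammaHodgeSectorNegative (IsCubeBetaRep)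
open Summit.KontsevichZagierPeriods.KontsevichZagierPeriods.BetaCancellationNegative (betaKernel)
open Summit.KontsevichZagierPeriods.KontsevichZagierPeriods.Theses.FermatIsogeny (BetaLinearSector)

namespace LinearFactor

/-- `κ(0) = 0` in `P`: the point representation of weight `0` has vanishing integrand, hence is a
relation. [cite: KontsevichZagier2001, §1.2 rule (1)] -/
theorem kap_zero (h0 : IsAlgebraic ℚ (0:ℝ)) : kap 0 h0 = 0 := by
  rw [kap]
  refine toFormalPeriod_eq_zero_of_mem (of_mem_relations_of_eqOn_zero _ fun x _ => ?_)
  simp [IntegralRep.integrand_constMul]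

/-- **The class of a pinned weighted product representation.** A representation with domain the
open unit square and integrand `c · x^{a-1}(1-x)^{b-1} · y^{e-1}(1-y)^{d-1}` on it (`0 < a, b, e, d`
rational, `c` real algebraic) has class `κ(c) · (β(a,b) · β(e,d))` in `P`: it is one
integrand-additivity move away from the `c`-scaling of the unweighted cube Beta representation of
`(![a,e], ![b,d])`, constants factor out (`KZ.toFormalPeriod_of_constMul`) and cube representations
are products of Beta classes (`cubeProduct_holds`). [cite: KontsevichZagier2001, §4.1] -/
theorem toFormalPeriod_pinned {a b e d : ℚ} (ha : 0 < a) (hb : 0 < b) (he : 0 < e) (hd : 0 < d)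
    (c : ℝ) (hc : IsAlgebraic ℚ c) (r : IntegralRep 2)
    (hrd : r.domain = {x | ∀ i, x i ∈ Set.Ioo (0:ℝ) 1})
    (hri : Set.EqOn r.integrand (fun x => c * (x 0) ^ ((a:ℝ) - 1) * (1 - x 0) ^ ((b:ℝ) - 1) *
      (x 1) ^ ((e:ℝ) - 1) * (1 - x 1) ^ ((d:ℝ) - 1)) r.domain) :
    toFormalPeriod (of r) = kap c hc * (betaClass a b * betaClass e d) := by
  obtain ⟨u, hud, hui⟩ := KZ.exists_cubeBetaRep (N := 2) ![a, e] ![b, d] (pos_vec ha hb he hd)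
  -- one integrand-additivity move: `r` and `c · u` have the same domain and agree on it
  have hru : Equivalent r (u.constMul c hc) := by
    refine of_sub_of_mem_relations_of_eqOn (by rw [IntegralRep.domain_constMul, hud, hrd]) ?_
    intro z hz
    have hzu : z ∈ u.domain := by rw [hud, ← hrd]; exact hz
    rw [hri hz, IntegralRep.integrand_constMul]
    simp only [hui hzu, Fin.prod_univ_two, Matrix.cons_val_zero, Matrix.cons_val_one]
    ring
  rw [hru.toFormalPeriod_eq, KZ.toFormalPeriod_of_constMul c hc u,
    cubeProduct_holds ![a, e] ![b, d] u (pos_vec ha hb he hd) ⟨hud, hui⟩]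
  simp only [Fin.prod_univ_two, Matrix.cons_val_zero, Matrix.cons_val_one]
  rfl

/-- **One instance of `BetaLinearSector` as an identity of `P`**: if `B(a,b) = q · B(a',b')` with `q`
real algebraic (`0 < a, b, a', b'`), then `β(a,b) = κ(q) · β(a',b')` in `P` — instantiate the sector
on `betaRep a b` and `q · betaRep a' b'` (equal values), then factor the constant out
(`KZ.toFormalPeriod_of_constMul`). [cite: KoblitzRohrlich1978, p. 1184] -/
theorem betaClass_eq_kap_mul (hL : BetaLinearSector) {a b a' b' : ℚ} {q : ℝ}
    (ha : 0 < a) (hb : 0 < b) (ha' : 0 < a') (hb' : 0 < b') (hq : IsAlgebraic ℚ q)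
    (hD : ProbabilityTheory.beta a b = q * ProbabilityTheory.beta a' b') :
    betaClass a b = kap q hq * betaClass a' b' := by
  set r : IntegralRep 1 := betaRep a b ha hb with hr
  set r' : IntegralRep 1 := (betaRep a' b' ha' hb').constMul q hq with hr'
  have hv : r.value = r'.value := by
    rw [hr, hr', IntegralRep.value_constMul, betaRep_value, betaRep_value, hD]
  have hEq : Equivalent r r' := by
    refine hL a b a' b' q ha hb ha' hb' hq r r' rfl ?_ rfl ?_ hv
    · intro x _
      rw [hr, betaRep_integrand]
      rfl
    · intro x _
      rw [hr', IntegralRep.integrand_constMul, betaRep_integrand]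
      simp only [betaKernel]
      ring
  rw [betaClass_eq _ _ ha hb, hEq.toFormalPeriod_eq, hr', KZ.toFormalPeriod_of_constMul,
    ← betaClass_eq _ _ ha' hb']
  rfl

end LinearFactor

open LinearFactor in
/-- **Stub `stub_linearFactor`, conditional form ⇐ `BetaLinearSector` (stmt-KontsevichZagierPeriods-3897)**
— the LIN step of the chain normal form tensored with `β(e,d)`: if `c · B(a,b) = c' · B(a',b')` with
`c, c'` real algebraic, then
`[(0,1)², c x^{a-1}(1-x)^{b-1} y^{e-1}(1-y)^{d-1}] ∼ [(0,1)², c' x^{a'-1}(1-x)^{b'-1} y^{e-1}(1-y)^{d-1}]`.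
In `P` the two classes are `κ(c) β(a,b) β(e,d)` and `κ(c') β(a',b') β(e,d)` (`toFormalPeriod_pinned`);
for `c = 0` both vanish (`c' = 0` since `B(a',b') > 0`, `κ(0) = 0`); for `c ≠ 0` the sector gives
`β(a,b) = κ(c'/c) β(a',b')` (`betaClass_eq_kap_mul`) and `κ(c) κ(c'/c) = κ(c')`; equal classes are
equivalent representations (`KZ.toFormalPeriod_eq_iff`). [cite: KontsevichZagier2001, §1.2] -/
theorem stub_linearFactor_of_betaLinearSector : Summit.KontsevichZagierPeriods.KontsevichZagierPeriods.Theses.FermatIsogeny.BetaLinearSector → ∀ (a b a' b' e d : ℚ) (c c' : ℝ), 0 < a → 0 < b → 0 < a' → 0 < b' → 0 < e → 0 < d → IsAlgebraic ℚ c → IsAlgebraic ℚ c' → c * (Real.Gamma a * Real.Gamma b / Real.Gamma ((a:ℝ) + b)) = c' * (Real.Gamma a' * Real.Gamma b' / Real.Gamma ((a':ℝ) + b')) → ∀ (r r' : Literature.NumberTheory.Transcendental.KZ.IntegralRep 2), r.domain = {x | ∀ i, x i ∈ Set.Ioo (0:ℝ) 1} → Set.EqOn r.integrand (fun x => c * (x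 0) ^ ((a:ℝ) - 1) * (1 - x 0) ^ ((b:ℝ) - 1) * (x 1) ^ ((e:ℝ) - 1) * (1 - x 1) ^ ((d:ℝ) - 1)) r.domain → r'.domain = {x | ∀ i, x i ∈ Set.Ioo (0:ℝ) 1} → Set.EqOn r'.integrand (fun x => c' * (x 0) ^ ((a':ℝ) - 1) * (1 - x 0) ^ ((b':ℝ) - 1) * (x 1) ^ ((e:ℝ) - 1) * (1 - x 1) ^ ((d:ℝ) - 1)) r'.domain → Literature.NumberTheory.Transcendental.KZ.Equivalent r r' := by
  intro hBL a b a' b' e d c c' ha hb ha' hb' he hd hc hc' hG r r' hrd hri hr'd hr'i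
  -- (1) the classes of the two pinned weighted product representations
  have h1 : toFormalPeriod (of r) = kap c hc * (betaClass a b * betaClass e d) :=
    toFormalPeriod_pinned ha hb he hd c hc r hrd hri
  have h2 : toFormalPeriod (of r') = kap c' hc' * (betaClass a' b' * betaClass e d) :=
    toFormalPeriod_pinned ha' hb' he hd c' hc' r' hr'd hr'i
  -- (4) equal classes are equivalent representations
  refine toFormalPeriod_eq_iff.mp ?_
  rw [h1, h2]
  have hB' : 0 < Real.Gamma a' * Real.Gamma b' / Real.Gamma ((a':ℝ) + b') :=
    ProbabilityTheory.beta_pos (by exact_mod_cast ha') (by exact_mod_cast hb')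
  rcases eq_or_ne c 0 with rfl | hc0
  · -- (2) `c = 0`: then `c' = 0` and both classes vanish
    have hc'0 : c' = 0 := by
      rw [zero_mul] at hG
      exact (mul_eq_zero.mp hG.symm).resolve_right hB'.ne'
    subst hc'0
    simp only [kap_zero, zero_mul]
  · -- (3) `c ≠ 0`: one instance of the beta-linear sector with the constant `c'/c`
    have hq : IsAlgebraic ℚ (c' / c) := by
      rw [div_eq_mul_inv]
      exact hc'.mul hc.inv
    have hD : ProbabilityTheory.beta a b = c' / c * ProbabilityTheory.beta a' b' := by
      simp only [ProbabilityTheory.beta]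
      rw [div_mul_eq_mul_div, eq_div_iff hc0]
      linear_combination hG
    rw [betaClass_eq_kap_mul hBL ha hb ha' hb' hq hD, ← mul_assoc, ← mul_assoc, ← kap_mul,
      kap_congr (hc.mul hq) hc' (mul_div_cancel₀ c' hc0), mul_assoc]

end Summit.KontsevichZagierPeriods.FermatIsogeny.BetaProductSectorStubs

end
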